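import Mathlib.Analysis.SpecialFunctions.Pow.Real
import Mathlib.Analysis.SpecialFunctions.Log.Basic
import Mathlib.Algebra.BigOperators.Field
import Summits.QuantumFields.BalabanUV.Beta.EriceRemainderEnclosureHistoryAutonomyComparisonContinuumGaugeCost

/-!
# EriceRemainderEnclosureHistoryAutonomyComparisonContinuumCrossingJump — (E128) **THE CROSSING JUMP OF THE SHARP STEP: ITS SIZE FROM THE BUDGET AT
# THE THRESHOLD, THE ALLOWANCE IT WOULD NEED, AND WHY NO ALLOWANCE CAN ALWAYS BE PAID.**  Continuum model of the comparison column
# (`HOME/b2b-balaban-beta-d4-p2/g100/README.md` §2, `g101/README.md` §1–§5, this generation's `g102/README.md`).  For the SHARP `u_0`-step of amplitude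
# `η′` at threshold `A*` the level-matched amplitude derivative `Z = ∂_η Φ_η(α)` solves the linear renewal equation around the perturbed base `Φ_η′`, which
# JUMPS at `A*` (`Φ(A*⁻) = Φ₀(A*) + η′`); consequently `Z` jumps DOWN, going down through the crossing pin `α_r*` of block `r` (window top at `A*`, `u =
# α_r*∕A*`), by exactly `Δ_r = (L_r∕2)A*^{-3∕2}·η′·W_r`, `W_r = ∫_window Z∕Φ dt` (README §1).  THIS FILE is the finite, derivative-free algebra of §1–§2 there:
# (§1) **`tau_le`**, **`jump_le`**, **`theta_le`**: from the window duration `k_r·Φ(A*⁻) ≤ A* − α_r*` (speed `≥ Φ(A*⁻)` below the threshold), the concavity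
# bound `ℓ_r(A*) ≤ (2−u)A*` and the BUDGET AT THE THRESHOLD `L_rℓ_r(A*)^{-1∕2} = σ_r·Φ₀(A*)`, `Σσ_r ≤ 1`:
#     `Δ_r ≤ (σ_r∕2)·√(2−u)·(1−u)·ξ(1−ξ)·⟨Z⟩_r ≤ (√2∕8)·σ_r·⟨Z⟩_r`,  `ξ = η′∕(Φ₀(A*)+η′)`,
# so the relative jump `θ_r = Δ_r∕Z(α_r*⁺)` is at most `0.1768·σ_r·R_r` with the reverse-Harnack ratio `R_r = ⟨Z⟩_r∕Z(α_r*⁺)` (largest at `ξ = 1∕2`, as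
# measured in g101's sweep j344283); (§2) **`quad_kappa_le_one`**, **`cost_allowance_le_one`**: the allowance gauge `Z·e^{φ}∕α` of g101 §5 pays the
# jumps iff inside every window `Σ −ln(1−θ) ≤ ln((2+√3)∕2) = 0.6243…` (then every inflated block coefficient `κ_r = 2e^{J_r} ≤ 2+√3` and the gauge cost
# `Σ_rσ_r(κ_r∕4 + 1∕(4κ_r)) ≤ 1`, by (E127) `block_cost_le_gen`); (§3) **`sum_neg_log_one_sub_le`**, **`allowance_of_ratio`**: superadditivity of
# `θ ↦ −ln(1−θ)` turns the per-crossing bound into «`R_r ≤ 2.62` at every crossing suffices».  README §3 then shows — by an exact-time solver — that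
# `R_r` is UNBOUNDED and `Z` DOES go negative (`Z(α_r*⁻) = Z(α_r*⁺) − Δ_r < 0` once the younger blocks' cascade has brought `Z(α_r*⁺)` below `Δ_r ≈ 0.12`:
# tower (10, 10⁴, 0.35), `ξ = 0.51`: `0.070 − 0.121 = −0.051`), so linear positivity around the sharp-step base — and with it g100's pointwise
# monotonicity (N) — is FALSE in the continuum model, while (E58′) itself holds there (`X∕η ≥ 0.054`): the set of amplitudes at which a given level is
# affected has relative measure `~ (loaded-zone time)∕k_R`.  Nothing in this file depends on that computation; it records the algebra both sides use.

Cell `pub-balaban`, β-function sub-cell, BINDER row D4 «RemainderConst leaves for Bałaban's split» (`HOME/BINDER-OWNERS.md`; owner lineage `b2b-balaban-beta-an4`;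
this file by co-owner #2 lineage `b2b-balaban-beta-d4-p2`, generation 102), β-FLOW TEAM duty (1), FREEZE (0) honoured (def-free; imports Mathlib and (E127) only;
restates nothing).

HONEST FRAMING (page 1, verbatim and binding).  *"Discharging BetaPertH makes Bałaban's UV stability UNCONDITIONAL — a real constructive-QFT result; it is
NOT the continuum limit and NOT the Clay problem."*  THIS FILE DISCHARGES NOTHING OF THE KIND.  Elementary real algebra about abstract reals standing for one
crossing of the cell's continuum model of an abstract flow with memory — hypotheses of a census, not facts; the form, signs, ages and moments of Bałaban's (1.22)
limit functional are NOT PRINTED ([I] p. 298; GAPS G-t4-U2-1∕-2) and NOT asserted.  Row D4 class UNCHANGED (critical-path width 0; instance 0∕1; D4 DISCHARGE NO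
DATE).  HONEST DEPENDENCY: continuum YM on T⁴ ⇐ BetaPertH ∧ nine spine estimates (0/9 proved); BetaPertH ⇐ (D1) ∧ (D4) ∧ CAP+tail; G-an2-4 gates asym, D1 and
NE2/3/4.  NOT CLAIMED: the lattice statement (E58′) for sharp∕steep large excesses, anything printed — NOT B12 Thm 2, NOT BetaPertH, NOT continuum, NOT Clay.

WHAT IS PROVED ([folklore]; 0 `def`, 0 sorry).  §1 `xi_mul_le`, `sqrt_two_sub_mul_le`, **`tau_le`**, **`jump_le`**, **`theta_le`**.  §2 **`quad_kappa_le_one`**,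
**`cost_allowance_le_one`**.  §3 `neg_log_one_sub_add_le`, **`sum_neg_log_one_sub_le`**, **`allowance_of_ratio`**.
-/

noncomputable section
open Finset Real

namespace Summit.QuantumFields.BalabanUV.Beta.EriceRemainderEnclosureHistoryAutonomyComparisonContinuumCrossingJump

/-! ## §1 The size of one crossing jump -/

/-- `ξ(1−ξ) ≤ 1∕4` (because `(2ξ−1)² ≥ 0`): the amplitude factor of the jump is largest at `ξ = 1∕2`, i.e. `η′ = Φ₀(A*)`. [folklore] -/
theorem xi_mul_le (ξ : ℝ) : ξ * (1 - ξ) ≤ 1 / 4 := by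
  nlinarith [sq_nonneg (2 * ξ - 1)]

/-- For `u ≥ 0` and `s ≥ 0` with `s² = 2 − u`: `s·(1−u) ≤ √2` (indeed `s ≤ √2` and `1 − u ≤ 1`). [folklore] -/
theorem sqrt_two_sub_mul_le {u s : ℝ} (hu0 : 0 ≤ u) (hs : 0 ≤ s) (hs2 : s ^ 2 = 2 - u) : s * (1 - u) ≤ Real.sqrt 2 := by
  have h1 : s ≤ Real.sqrt 2 := by
    rw [show s = Real.sqrt (s ^ 2) from (Real.sqrt_sq hs).symm]
    exact Real.sqrt_le_sqrt (by linarith)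
  have h2 : s * (1 - u) ≤ s * 1 := mul_le_mul_of_nonneg_left (by linarith) hs
  linarith

/-- **THE DURATION FACTOR `τ_r(A*)` FROM THE BUDGET AT THE THRESHOLD.**  Block `r` crosses at the pin `αs = u·A` (`0 ≤ u ≤ 1`, `A > 0` the threshold,
`rA = √A` — any `rA > 0` here): its window from the pin to the threshold lasts `k` with `k·ΦAm ≤ A − αs` (the speed below the threshold is at least `ΦAm = Φ(A*⁻) = Φ0A + η`,
`Φ0A = Φ₀(A*) > 0`, `η ≥ 0`); its weight satisfies `L ≤ σ·Φ0A·rA·s` with `s = √(2−u)` — this is `L·A^{-1∕2} ≤ σ·Φ₀(A*)·√(ℓ_r(A*)∕A*)` with the share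
`σ = L·ℓ_r(A*)^{-1∕2}∕Φ₀(A*)` at the threshold and the concavity bound `ℓ_r(A*) ≤ (2−u)·A*`.  Then `τ := L∕(2·A·rA)·k` (`= (L∕2)A*^{-3∕2}k_r`) obeys
`τ ≤ (σ∕2)·s·(1−u)·(1−ξ)`, `ξ = η∕ΦAm`. [folklore] -/
theorem tau_le {A rA u s k L σ Φ0A η ΦAm ξ τ : ℝ} (hA : 0 < A) (hrA : 0 < rA) (hs : 0 ≤ s)
    (hΦ0 : 0 < Φ0A) (hη : 0 ≤ η) (hΦAm : ΦAm = Φ0A + η) (hξ : ξ = η / ΦAm) (hσ : 0 ≤ σ)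
    (hk0 : 0 ≤ k) (hk : k * ΦAm ≤ A - u * A) (hL : L ≤ σ * Φ0A * rA * s) (hτ : τ = L / (2 * A * rA) * k) :
    τ ≤ σ / 2 * s * (1 - u) * (1 - ξ) := by
  have hΦAm0 : 0 < ΦAm := by rw [hΦAm]; linarith
  have h1ξ : 1 - ξ = Φ0A / ΦAm := by
    rw [hξ, hΦAm]; field_simp; ring
  -- k ≤ A(1-u)/ΦAm
  have hk' : k ≤ A * (1 - u) / ΦAm := by
    rw [le_div_iff₀ hΦAm0]; linarith
  have hArA : 0 < 2 * A * rA := by positivity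
  rw [hτ, h1ξ]
  calc L / (2 * A * rA) * k ≤ σ * Φ0A * rA * s / (2 * A * rA) * (A * (1 - u) / ΦAm) := by
        apply mul_le_mul (div_le_div_of_nonneg_right hL hArA.le) hk' hk0
        exact div_nonneg (by positivity) hArA.le
    _ = σ / 2 * s * (1 - u) * (Φ0A / ΦAm) := by
        field_simp

/-- **THE JUMP.**  With `τ` as in `tau_le`, the jump `Δ = L∕(2·A·rA)·η·W` of the amplitude derivative at the crossing pin, where the window functional obeys
`W·ΦAm ≤ k·Zbar` (`W = ∫_window Z∕Φ dt ≤ k⟨Z⟩∕Φ(A*⁻)` because `Φ ≥ Φ(A*⁻)` below the threshold; `Zbar = ⟨Z⟩_r ≥ 0` the time average of `Z` over the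
window), satisfies `Δ ≤ (σ∕2)·s·(1−u)·ξ·(1−ξ)·Zbar`. [folklore] -/
theorem jump_le {A rA u s k L σ Φ0A η ΦAm ξ τ W Zbar Δ : ℝ} (hA : 0 < A) (hrA : 0 < rA) (hs : 0 ≤ s)
    (hΦ0 : 0 < Φ0A) (hη : 0 ≤ η) (hΦAm : ΦAm = Φ0A + η) (hξ : ξ = η / ΦAm) (hσ : 0 ≤ σ)
    (hk0 : 0 ≤ k) (hk : k * ΦAm ≤ A - u * A) (hL0 : 0 ≤ L) (hL : L ≤ σ * Φ0A * rA * s) (hτ : τ = L / (2 * A * rA) * k)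
    (hZbar : 0 ≤ Zbar) (hW : W * ΦAm ≤ k * Zbar) (hΔ : Δ = L / (2 * A * rA) * η * W) :
    Δ ≤ σ / 2 * s * (1 - u) * ξ * (1 - ξ) * Zbar := by
  have hΦAm0 : 0 < ΦAm := by rw [hΦAm]; linarith
  have hτle := tau_le hA hrA hs hΦ0 hη hΦAm hξ hσ hk0 hk hL hτ
  have hc0 : 0 ≤ L / (2 * A * rA) := div_nonneg hL0 (by positivity)
  have hW' : W ≤ k * Zbar / ΦAm := by rw [le_div_iff₀ hΦAm0]; exact hW
  have hξ0 : 0 ≤ ξ := by rw [hξ]; exact div_nonneg hη hΦAm0.le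
  -- Δ = (L/(2 A rA)) η W ≤ (L/(2 A rA)) η (k Zbar/ΦAm) = τ ξ Zbar
  have h1 : Δ ≤ τ * ξ * Zbar := by
    rw [hΔ]
    calc L / (2 * A * rA) * η * W ≤ L / (2 * A * rA) * η * (k * Zbar / ΦAm) :=
          mul_le_mul_of_nonneg_left hW' (mul_nonneg hc0 hη)
      _ = τ * ξ * Zbar := by rw [hτ, hξ]; field_simp
  have h2 : τ * ξ * Zbar ≤ σ / 2 * s * (1 - u) * (1 - ξ) * ξ * Zbar :=
    mul_le_mul_of_nonneg_right (mul_le_mul_of_nonneg_right hτle hξ0) hZbar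
  calc Δ ≤ τ * ξ * Zbar := h1
    _ ≤ σ / 2 * s * (1 - u) * (1 - ξ) * ξ * Zbar := h2
    _ = σ / 2 * s * (1 - u) * ξ * (1 - ξ) * Zbar := by ring

/-- **THE RELATIVE JUMP AGAINST THE REVERSE-HARNACK RATIO.**  If `Δ ≤ (σ∕2)s(1−u)ξ(1−ξ)·Zbar` (`jump_le`), `Za = Z(α_r*⁺) > 0` and `Zbar ≤ R·Za` (the ratio
of the window's time average to the value at its bottom), then `θ = Δ∕Za ≤ (√2∕8)·σ·R ≤ 0.1768·σ·R` — using `ξ(1−ξ) ≤ 1∕4` and `s(1−u) ≤ √2`. [folklore] -/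
theorem theta_le {u s σ ξ Zbar Δ Za R : ℝ} (hu0 : 0 ≤ u) (hu1 : u ≤ 1) (hs : 0 ≤ s) (hs2 : s ^ 2 = 2 - u) (hσ : 0 ≤ σ) (hξ0 : 0 ≤ ξ) (hξ1 : ξ ≤ 1)
    (hZa : 0 < Za) (hZbar : 0 ≤ Zbar) (hR : Zbar ≤ R * Za) (hΔ : Δ ≤ σ / 2 * s * (1 - u) * ξ * (1 - ξ) * Zbar) :
    Δ / Za ≤ Real.sqrt 2 / 8 * σ * R := by
  have h1 : s * (1 - u) ≤ Real.sqrt 2 := sqrt_two_sub_mul_le hu0 hs hs2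
  have h2 : ξ * (1 - ξ) ≤ 1 / 4 := xi_mul_le ξ
  have hsu : 0 ≤ s * (1 - u) := mul_nonneg hs (by linarith)
  have hξξ : 0 ≤ ξ * (1 - ξ) := mul_nonneg hξ0 (by linarith)
  have h3 : σ / 2 * s * (1 - u) * ξ * (1 - ξ) * Zbar ≤ σ / 2 * Real.sqrt 2 * (1 / 4) * (R * Za) := by
    have e1 : σ / 2 * s * (1 - u) * ξ * (1 - ξ) * Zbar = σ / 2 * (s * (1 - u)) * (ξ * (1 - ξ)) * Zbar := by ring
    rw [e1]
    have hR0 : 0 ≤ R * Za := le_trans hZbar hR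
    calc σ / 2 * (s * (1 - u)) * (ξ * (1 - ξ)) * Zbar ≤ σ / 2 * Real.sqrt 2 * (1 / 4) * Zbar := by
          apply mul_le_mul_of_nonneg_right _ hZbar
          apply mul_le_mul (mul_le_mul_of_nonneg_left h1 (by positivity)) h2 hξξ (by positivity)
      _ ≤ σ / 2 * Real.sqrt 2 * (1 / 4) * (R * Za) := mul_le_mul_of_nonneg_left hR (by positivity)
  rw [div_le_iff₀ hZa]
  calc Δ ≤ σ / 2 * Real.sqrt 2 * (1 / 4) * (R * Za) := hΔ.trans h3
    _ = Real.sqrt 2 / 8 * σ * R * Za := by ring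

/-! ## §2 The allowance the gauge can pay -/

/-- For `2 ≤ κ ≤ 2 + √3`: `κ∕4 + 1∕(4κ) ≤ 1` (the roots of `κ² − 4κ + 1` are `2 ∓ √3`).  With `κ = 2e^{J}` the inflated coefficient of a block whose window
carries the allowance `J`, this is affordability `J ≤ ln((2+√3)∕2) = 0.6243…`. [folklore] -/
theorem quad_kappa_le_one {κ : ℝ} (h2 : 2 ≤ κ) (hκ : κ ≤ 2 + Real.sqrt 3) : κ / 4 + 1 / (4 * κ) ≤ 1 := by
  have hκ0 : 0 < κ := by linarith
  have h3 : Real.sqrt 3 ^ 2 = 3 := Real.sq_sqrt (by norm_num)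
  have hq : κ ^ 2 - 4 * κ + 1 ≤ 0 := by nlinarith [h3, Real.sqrt_nonneg 3]
  have e : κ / 4 + 1 / (4 * κ) - 1 = (κ ^ 2 - 4 * κ + 1) / (4 * κ) := by field_simp; ring
  have : (κ ^ 2 - 4 * κ + 1) / (4 * κ) ≤ 0 := div_nonpos_of_nonpos_of_nonneg hq (by positivity)
  linarith

variable {ι : Type*}

/-- **THE GAUGE COST WITH ALLOWANCES IS AT MOST ONE.**  Blocks `r ∈ s` at the pin `α` (`Φa` the speed there) as in (E127) `block_cost_le_gen`: tops `ℓ_r ≥ α`,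
top speeds `0 < Φt_r ≤ Φa`, shares `c_r ≥ 0` with the BUDGET `Σc_r ≤ Φa`, kernel weights `m_r = (c_r∕2)Φt_r∕ℓ_r`, INFLATED coefficients `K_r ≤ κ_rΦt_r∕ℓ_r`
(`κ_r = 2e^{J_r}` — the window bound of the allowance gauge `W_r ≤ (Z∕α)e^{J_r}J̄_r` moved onto `K_r`) with `2 ≤ κ_r ≤ 2 + √3`, and `0 ≤ J_r ≤ (ℓ_r² −
α²)∕(2Φt_r²)`.  Then `α·(Σm_r)∕Φa² + Σ m_rK_rJ_r∕Φa ≤ 1`: between crossings the allowance gauge `Z·e^{φ}∕α` needs no further allowance. [folklore] -/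
theorem cost_allowance_le_one (s : Finset ι) {α Φa : ℝ} {ℓ Φt c m K J κ : ι → ℝ} (hα : 0 < α) (hΦa : 0 < Φa)
    (hαℓ : ∀ r ∈ s, α ≤ ℓ r) (hΦt : ∀ r ∈ s, 0 < Φt r) (hΦta : ∀ r ∈ s, Φt r ≤ Φa) (hc : ∀ r ∈ s, 0 ≤ c r)
    (hm : ∀ r ∈ s, m r = c r / 2 * (Φt r / ℓ r)) (hκ2 : ∀ r ∈ s, 2 ≤ κ r) (hκ : ∀ r ∈ s, κ r ≤ 2 + Real.sqrt 3)
    (hK : ∀ r ∈ s, K r ≤ κ r * Φt r / ℓ r) (hJ0 : ∀ r ∈ s, 0 ≤ J r) (hJ : ∀ r ∈ s, J r ≤ (ℓ r ^ 2 - α ^ 2) / (2 * Φt r ^ 2))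
    (hbudget : ∑ r ∈ s, c r ≤ Φa) :
    α * (∑ r ∈ s, m r) / Φa ^ 2 + ∑ r ∈ s, m r * K r * J r / Φa ≤ 1 := by
  have hsplit : α * (∑ r ∈ s, m r) / Φa ^ 2 + ∑ r ∈ s, m r * K r * J r / Φa
      = ∑ r ∈ s, (α * m r / Φa ^ 2 + m r * K r * J r / Φa) := by
    rw [mul_sum, sum_div, ← sum_add_distrib]
  rw [hsplit]
  have hterm : ∀ r ∈ s, α * m r / Φa ^ 2 + m r * K r * J r / Φa ≤ c r / Φa := by
    intro r hr
    have hκ0 : 0 < κ r := by have := hκ2 r hr; linarith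
    have h1 := EriceRemainderEnclosureHistoryAutonomyComparisonContinuumGaugeCost.block_cost_le_gen hα (hαℓ r hr) (hΦt r hr) (hΦta r hr) (hc r hr) hκ0
      (hm r hr) (hK r hr) (hJ0 r hr) (hJ r hr)
    have h2 : κ r / 4 + 1 / (4 * κ r) ≤ 1 := quad_kappa_le_one (hκ2 r hr) (hκ r hr)
    have hcΦ : 0 ≤ c r / Φa := div_nonneg (hc r hr) hΦa.le
    calc α * m r / Φa ^ 2 + m r * K r * J r / Φa ≤ c r / Φa * (κ r / 4 + 1 / (4 * κ r)) := h1
      _ ≤ c r / Φa * 1 := mul_le_mul_of_nonneg_left h2 hcΦ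
      _ = c r / Φa := mul_one _
  calc ∑ r ∈ s, (α * m r / Φa ^ 2 + m r * K r * J r / Φa) ≤ ∑ r ∈ s, c r / Φa := sum_le_sum hterm
    _ = (∑ r ∈ s, c r) / Φa := by rw [sum_div]
    _ ≤ Φa / Φa := div_le_div_of_nonneg_right hbudget hΦa.le
    _ = 1 := div_self hΦa.ne'

/-! ## §3 From per-crossing jumps to the allowance inside a window -/

/-- Superadditivity of `θ ↦ −log(1−θ)` on `[0,1)`: for `a, b ≥ 0` with `a + b < 1`, `−log(1−a) − log(1−b) ≤ −log(1−a−b)` (because `(1−a)(1−b) ≥ 1−a−b`).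
[folklore] -/
theorem neg_log_one_sub_add_le {a b : ℝ} (ha : 0 ≤ a) (hb : 0 ≤ b) (hab : a + b < 1) :
    -Real.log (1 - a) + -Real.log (1 - b) ≤ -Real.log (1 - (a + b)) := by
  have h1a : 0 < 1 - a := by linarith
  have h1b : 0 < 1 - b := by linarith
  have h1ab : 0 < 1 - (a + b) := by linarith
  have hprod : 1 - (a + b) ≤ (1 - a) * (1 - b) := by nlinarith [mul_nonneg ha hb]
  have := Real.log_le_log h1ab hprod
  rw [Real.log_mul h1a.ne' h1b.ne'] at this
  linarith

/-- **THE ALLOWANCE SPENT INSIDE ONE WINDOW.**  If the crossings `i ∈ t` inside a window have relative jumps `0 ≤ θ_i` with `Σθ_i ≤ S < 1`, the allowance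
they consume is `Σ −log(1−θ_i) ≤ −log(1−S)` (superadditivity and monotonicity). [folklore] -/
theorem sum_neg_log_one_sub_le (t : Finset ι) {θ : ι → ℝ} {S : ℝ} (hθ : ∀ i ∈ t, 0 ≤ θ i) (hsum : ∑ i ∈ t, θ i ≤ S) (hS : S < 1) :
    ∑ i ∈ t, -Real.log (1 - θ i) ≤ -Real.log (1 - S) := by
  classical
  -- first: Σ -log(1-θ_i) ≤ -log(1 - Σθ_i), by induction on t
  have key : ∀ (t' : Finset ι), (∀ i ∈ t', 0 ≤ θ i) → ∑ i ∈ t', θ i < 1 →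
      ∑ i ∈ t', -Real.log (1 - θ i) ≤ -Real.log (1 - ∑ i ∈ t', θ i) := by
    intro t'
    induction t' using Finset.induction_on with
    | empty => intro _ _; simp
    | @insert j u hj ih =>
      intro hpos hlt
      rw [sum_insert hj] at hlt ⊢
      rw [sum_insert hj]
      have hju : 0 ≤ θ j := hpos j (mem_insert_self j u)
      have hu0 : ∀ i ∈ u, 0 ≤ θ i := fun i hi => hpos i (mem_insert_of_mem hi)
      have husum : 0 ≤ ∑ i ∈ u, θ i := sum_nonneg hu0
      have hult : ∑ i ∈ u, θ i < 1 := by linarith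
      have h1 := ih hu0 hult
      have h2 := neg_log_one_sub_add_le hju husum hlt
      linarith
  have hlt : ∑ i ∈ t, θ i < 1 := lt_of_le_of_lt hsum hS
  have h1 := key t hθ hlt
  have hmono : -Real.log (1 - ∑ i ∈ t, θ i) ≤ -Real.log (1 - S) := by
    have := Real.log_le_log (by linarith : 0 < 1 - S) (by linarith : 1 - S ≤ 1 - ∑ i ∈ t, θ i)
    linarith
  exact h1.trans hmono

/-- **«`R_r ≤ 2.62` AT EVERY CROSSING WOULD SUFFICE».**  If every crossing `i ∈ t` inside a window has `θ_i ≤ (√2∕8)·σ_i·Rbar` (`theta_le` with a common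
bound `Rbar ≥ 0` on the reverse-Harnack ratios), the shares at the threshold have `Σσ_i ≤ 1`, and `(√2∕8)·Rbar ≤ S` with `S < 1`, then the allowance in
the window is at most `−log(1−S)`; affordability (`quad_kappa_le_one`) asks `−log(1−S) ≤ log((2+√3)∕2)`, i.e. `S ≤ √3∕(2+√3) = 0.464…`, i.e. `Rbar ≤ 2.62…`.
README §3: `R_r` is in fact UNBOUNDED (13.5 measured) and `θ > 1` occurs — the hypothesis fails, not the algebra. [folklore] -/
theorem allowance_of_ratio (t : Finset ι) {θ σ : ι → ℝ} {Rbar S : ℝ} (hθ0 : ∀ i ∈ t, 0 ≤ θ i)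
    (hθ : ∀ i ∈ t, θ i ≤ Real.sqrt 2 / 8 * σ i * Rbar) (hσsum : ∑ i ∈ t, σ i ≤ 1) (hR : 0 ≤ Rbar)
    (hRS : Real.sqrt 2 / 8 * Rbar ≤ S) (hS : S < 1) :
    ∑ i ∈ t, -Real.log (1 - θ i) ≤ -Real.log (1 - S) := by
  apply sum_neg_log_one_sub_le t hθ0 _ hS
  calc ∑ i ∈ t, θ i ≤ ∑ i ∈ t, Real.sqrt 2 / 8 * σ i * Rbar := sum_le_sum hθ
    _ = Real.sqrt 2 / 8 * Rbar * ∑ i ∈ t, σ i := by rw [mul_sum]; exact sum_congr rfl fun i _ => by ring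
    _ ≤ Real.sqrt 2 / 8 * Rbar * 1 := mul_le_mul_of_nonneg_left hσsum (by positivity)
    _ ≤ S := by linarith

end Summit.QuantumFields.BalabanUV.Beta.EriceRemainderEnclosureHistoryAutonomyComparisonContinuumCrossingJump

end
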